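import Summits.Ventures.CertifiedManyBodySolver.Certificates.HubbardSquare_tpm3o10_U29o5_toyKernelCert_bondRow
import HarnessLib

/-!
# STEP-0 of «tier P», third toy: a window certificate WITH AN EQUATION-OF-MOTION ROW replayed in the kernel — local `↑`-charge
# STATIONARITY `Re ω([H^{t,t',U}_{W}, n_{0↑}]) = 0` for every torus-limit ground state of the `t–t'` Hubbard model at
# `(t, t', U) = (1, −3/10, 29/5)`, where the kernel VERIFIES the commutator algebra: the explicit 16-term current-divergence word
# `Σ_{v ∼ 0} (c†_{0↑}c_{v↑} − c†_{v↑}c_{0↑}) − (3/10)·Σ_{v ∼' 0} (c†_{0↑}c_{v↑} − c†_{v↑}c_{0↑})` IS `[H_W, n_{0↑}]` — ZERO hypotheses, NO claim node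

HONEST FRAMING: a TOY (stationarity of a local density under the dynamics is textbook); the point is that the EOM family of the
kernel form (`eomTβ`: multiplier words over the inner window commuted with the WINDOW HAMILTONIAN term list `hamTermsIdx`, i.e. the
dictionary `termOp_hamTermsIdx` used in anger — 89 Hamiltonian terms × the multiplier word, normal-ordered and cancelled against the
explicit objective by `CARPoly.normalize`, `decide +kernel`) is exercised end to end, completing the coverage of the certificate
families begun in `…_toyKernelCert_pauliRow` (SOS factor) and `…_toyKernelCert_bondRow` (translation move + density row). Two
certificates (multiplier `+1` and `−1` on `n_{0↑}`) give the two rows `0 ≤ ±Re ω(J)`, hence the equality. Trust base: the Lean kernel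
(std axioms). No number of record; no existing claim node discharged; CONTROL/CALIBRATION context (wording (xx1)); silent on
ρ_s = 0 / presence / T_c / phase; nothing about La₂CuO₄; no summit statement is proved by this file. Seat hubbard-obs-p2 (STIFFNESS),
`prover-hubbard-obs-p2-g22-0`, zero compute.

References: X. Han, arXiv:2006.06002 §3 (stationarity constraints `⟨[H, O]⟩ = 0`) [Han2020Bootstrap]; J. Wang et al., PRX 14 (2024)
031006 §III [WangEtAl2024].
-/

noncomputable section

namespace Summit.Ventures.CertifiedManyBodySolver

namespace CARPolyWindow

namespace Toy3x3

open Summit.Ventures.CertifiedQuantumChemistry Summit.Ventures.CertifiedQuantumChemistry.CARPoly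
open Literature.MathematicalPhysics.QuantumLattice Literature.MathematicalPhysics.QuantumLattice.HubbardWave0
open Literature.MathematicalPhysics.QuantumManyBody.StateRelaxation
open Literature.Probability.LatticeModels ThermodynamicLimit Filter Topology
open Matrix
open scoped ComplexOrder BigOperators

/-! ## The certificate data (letters: index `0` = origin; `1…4` = `±e₁, ±e₂`; `5…8` = the diagonal neighbours; spin `0 = ↑`) -/

/-- One oriented pair of current terms `c · (c†_{0↑} c_{v↑} − c†_{v↑} c_{0↑})` for the neighbour with index `j`. [folklore] -/
def curT (j : Fin 9) (c : ℚ) : Terms (Orb (Fin 9)) :=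
  [([(orb 0 0, true), (orb j 0, false)], c), ([(orb j 0, true), (orb 0 0, false)], -c)]

/-- The objective: the explicit `↑`-current divergence at the origin, `J = Σ_{v ∈ NN} (c†_0 c_v − c†_v c_0) − (3/10) Σ_{v ∈ diag} (…)`
(= `[H_W, n_{0↑}]` at `(t, t') = (1, −3/10)` — which is what the kernel checks). [cite: Han2020Bootstrap, §3] -/
def TXc : Terms (Orb (Fin 9)) :=
  curT 1 1 ++ curT 2 1 ++ curT 3 1 ++ curT 4 1 ++
    curT 5 (-3 / 10) ++ curT 6 (-3 / 10) ++ curT 7 (-3 / 10) ++ curT 8 (-3 / 10)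

/-- The multiplier word `c · n_{0↑}` over the inner (spin) letters of `Λ = {0}`. [folklore] -/
def EBc (c : ℚ) : List (Terms (Fin 2)) := [[([((0 : Fin 2), true), ((0 : Fin 2), false)], c)]]

/-- The residual of the stationarity certificate with objective `±J` and multiplier `±1`: `±J − [H_W, ±n_{0↑}]` (no other family).
[cite: Han2020Bootstrap, §3] -/
def curResid (c : ℚ) : Terms (Orb (Fin 9)) :=
  residT (scaleT c TXc) (fun _ => 0) 0 (fun σ => orb 0 σ) 0 0 0 0 TE 0 [] TH fb (EBc c) (fun l : Fin 0 => l.elim0)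
    (fun l : Fin 0 => l.elim0) [] []

/-- **Kernel evaluation, sign `+`**: `0 ≤ lowerConst (normalize (J − [H_W, n_{0↑}]))` — the normaliser expands the 89-term window
Hamiltonian against `n_{0↑}` and cancels the result against the explicit 16-term current word. [cite: Han2020Bootstrap, §3] -/
theorem cur_lowerConst_pos :
    (0 : ℚ) ≤ lowerConst (CARPoly.normalize enc 32 (curResid 1)) + ((0 : ℚ) + 0) * ((7 / 8 : ℚ) / 2 - 0) := by
  decide +kernel

/-- **Kernel evaluation, sign `−`**: `0 ≤ lowerConst (normalize (−J − [H_W, −n_{0↑}]))`. [cite: Han2020Bootstrap, §3] -/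
theorem cur_lowerConst_neg :
    (0 : ℚ) ≤ lowerConst (CARPoly.normalize enc 32 (curResid (-1))) + ((0 : ℚ) + 0) * ((7 / 8 : ℚ) / 2 - 0) := by
  decide +kernel

/-! ## The end-to-end theorem -/

/-- Membership-proof irrelevance for ordered sites. [folklore] -/
private theorem pt_congr_site₃ {x y : Site 2} (hx : x ∈ W) (hy : y ∈ W) (h : x = y) :
    PolySite.pt x hx = PolySite.pt y hy := by
  subst h; rfl

/-- **STEP-0, third toy: the affine-N claim-node predicate for `±J`, value `0`, from the kernel-replayed EOM certificate — ZERO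
hypotheses.** [cite: WangEtAl2024, §III] -/
theorem cur_affineOrbitLowerRowN (c : ℚ)
    (hc : (0 : ℚ) ≤ lowerConst (CARPoly.normalize enc 32 (curResid c)) + ((0 : ℚ) + 0) * ((7 / 8 : ℚ) / 2 - 0)) :
    SquareTTPrimeCorrAffineOrbitLowerRowN (((-3 / 10 : ℚ)) : ℝ) (((29 / 5 : ℚ)) : ℝ) 0 0 0 0 0 0 (7 / 8) {1} W
      (termOp d (scaleT c TXc)) := by
  have hz : (0 : Site 2) ∈ W := zero_mem_thicken_zero 1
  have h1 : (1 : DihedralGroup 4) ∈ ({1} : Finset (DihedralGroup 4)) := Finset.mem_singleton_self 1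
  have hmul : ∀ a ∈ ({1} : Finset (DihedralGroup 4)), ∀ b ∈ ({1} : Finset (DihedralGroup 4)),
      a * b ∈ ({1} : Finset (DihedralGroup 4)) := by
    intro a ha b hb
    rw [Finset.mem_singleton] at ha hb ⊢
    rw [ha, hb, mul_one]
  have hΛ : ({0} : Finset (Site 2)) ⊆ W := Finset.singleton_subset_iff.2 hz
  have hx0 : xs 0 = 0 := xs_zero
  have ho : ∀ σ : Fin 2, d (orb 0 σ) = orb (PolySite.pt 0 hz) σ := by
    intro σ
    rw [d_orb, pt_congr_site₃ (xs_mem 0) hz hx0]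
  have hf : ∀ σ : Fin 2, d (fb σ) = Orb.embMap (PolySite.incl hΛ) (dΛb σ) := by
    intro σ
    rw [fb, d_orb, pt_congr_site₃ (xs_mem 0) (hΛ (Finset.mem_singleton_self 0)) hx0]
    rfl
  have hH : termOp d TH = (hubbardTTPrimeFermionInteraction 1 (((-3 / 10 : ℚ)) : ℝ) (((29 / 5 : ℚ)) : ℝ)).localHamiltonian W := by
    rw [TH, termOp_hamTermsIdx 1 (-3 / 10) (29 / 5) xs xs_mem xs_injective xs_cover d d_orb, Rat.cast_one]
  have hE : termOp d TE = fermionEmbed (PolySite.incl (subset_refl W))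
      ((hubbardTTPrimeFermionInteraction 1 (((-3 / 10 : ℚ)) : ℝ) (((29 / 5 : ℚ)) : ℝ)).meanEnergyObs 1) := by
    rw [TE, termOp_energyTermsIdx 1 (-3 / 10) (29 / 5) xs xs_mem (subset_refl W) ix xs_ix_of_mem d d_orb, Rat.cast_one]
  exact affineOrbitLowerRowN_of_kernelCert (-3 / 10) (29 / 5) (by norm_num) hΛ (subset_refl W) (subset_refl W) hz h1 hmul
    d d_injective enc 32 dΛb fb hf (fun p => (ofLex p).2) (fun _ => rfl) TH hH TE hE (fun σ => orb 0 σ) ho (scaleT c TXc)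
    (fun _ => 0) 0 0 0 0 0 0 [] (EBc c) (fun l : Fin 0 => l.elim0) (fun l => l.elim0) (fun l : Fin 0 => l.elim0)
    (fun l : Fin 0 => l.elim0) (fun l : Fin 0 => l.elim0) (fun l => l.elim0) (fun l : Fin 0 => l.elim0) []
    (fun wc hwc => absurd hwc (List.not_mem_nil)) [] (by norm_num) hc

/-- **THE STATIONARITY ROW, KERNEL-REPLAYED**: for every density `x ∈ [0, 2)` and every torus limit `ω` of unit sector ground
states of `hubbardTorusTT' L 1 (−3/10) (29/5)` along `L → ∞`, the explicit `↑`-current divergence at the origin has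
`Re ω(J) = 0` (both signs from the two certificates). [cite: Han2020Bootstrap, §3] -/
theorem toy_current_row (x : ℝ) (hx0 : 0 ≤ x) (hx2 : x < 2) (ω : InfVolFermionState 2) (Ls : ℕ → ℕ)
    (ψ : ∀ L, Fock (Orb (FermionTorus 2 L))) (hLs : Tendsto Ls atTop atTop)
    (hψ : ∀ j, IsGroundStateInSector (hubbardTorusTT' (Ls j) 1 (((-3 / 10 : ℚ)) : ℝ) (((29 / 5 : ℚ)) : ℝ)) (rectN x (Ls j)) 0 (ψ (Ls j)))
    (hψ1 : ∀ j, star (ψ (Ls j)) ⬝ᵥ ψ (Ls j) = 1) (hω : ω.IsTorusLimitOf ψ Ls) :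
    (ω.expect W (termOp d TXc)).re = 0 := by
  have hp := cur_affineOrbitLowerRowN 1 cur_lowerConst_pos x hx0 hx2 ω Ls ψ hLs hψ hψ1 hω
  have hn := cur_affineOrbitLowerRowN (-1) cur_lowerConst_neg x hx0 hx2 ω Ls ψ hLs hψ hψ1 hω
  rw [termOp_scaleT, Finset.sum_singleton, Finset.card_singleton, Nat.cast_one, inv_one, one_mul,
    ω.expect_fermionEmbed_d4Emb_one_zero, map_smul] at hp hn
  rw [Rat.cast_one, one_smul] at hp
  rw [Rat.cast_neg, Rat.cast_one, neg_one_smul, Complex.neg_re] at hn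
  push_cast at hp hn
  linarith

end Toy3x3

end CARPolyWindow

end Summit.Ventures.CertifiedManyBodySolver

end
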